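import Summits.HodgeConjecture.HodgeConjecture.Theses.HeckePrymWeil
import Summits.HodgeConjecture.HodgeConjecture.Theorems.WeilTwelvefoldsSqrtMinus7.Negative.LadderTyping

/-!
# Sketch (gen 2) — crux-ideate round 1, ideator k = 2, crux `HeckePrymWeil.WeilTenfoldsSqrtMinus11`
(item stmt-HodgeConjecture-1262).  First lemmas of the third idea card `weil-projector-graph-seeds`,
stated over existing declarations only.

* `WeilTwelvefoldsSqrtMinus11Hyp` — the typed (all-discriminant) shadow of the card's transfer
  statement C⁺ (Hodge–Weil classes of `ℚ(√-11)` TWELVEFOLDS); `crux_of_twelvefolds` — together with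
  the route's support item `WeilDescending` it implies the crux (kernel-checked: one descending step
  `(p, n) = (11, 5)`).
* `WeilProjectorPolynomial n` — the arithmetic core of the SEED: a polynomial `p ∈ ℂ[X]` taking the
  value `1` at the two pure Weil eigenvalues `(1 ± i√11)^{2n}` of `(𝟙+φ)^*` and `0` at every other
  eigenvalue `(1+i√11)^a (1-i√11)^b`, `0 ≤ a, b ≤ 2n`, of `(𝟙+φ)^*` on `H^*(A)`; then
  `p(Γ_{𝟙+φ}) = Σ_j c_j Γ_{(𝟙+φ)^j}` is an algebraic cycle on `A × A` whose class is EXACTLY the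
  projector onto the Weil plane, i.e. the Hodge–Weil class of the `4n`-fold `A × A^c`.
  `weilProjectorPolynomial_holds` proves it for every `n ≥ 1` from the landed separation lemmas
  (`…Theorems.WeilTwelvefoldsSqrtMinus7.Negative.mixed_eq_plus_iff_of_four_le`) and Lagrange
  interpolation.
-/

noncomputable section

open CategoryTheory Complex Polynomial

namespace Summit.HodgeConjecture.HodgeConjecture.Cruxes.WeilTenfoldsSqrtMinus11.IdeatorTwoG2

open Literature.AlgebraicGeometry Literature.AlgebraicGeometry.HodgeTheory
open Summit.HodgeConjecture.HodgeConjecture.Theses.HeckePrymWeil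
open Summit.HodgeConjecture.HodgeConjecture.Theorems.WeilTwelvefoldsSqrtMinus7.Negative

/-- The crux, by name. -/
abbrev Crux : Prop := WeilTenfoldsSqrtMinus11

/-! ## (1) The transfer, typed in its all-discriminant form -/

/-- Hodge–Weil classes are algebraic on every complex abelian TWELVEFOLD `A` with `φ ≫ φ = -11`
(`K = ℚ(√-11)`, signature `(6,6)`), typed exactly like the rungs of `HodgeWeilLadder`.  The card's
transfer statement C⁺ is the restriction of this to the HYPERBOLIC component `det H = 1` (the component
containing every `A₆ × A₆^c`, every `X × X̂` and every `B ⊗ O_K`); the discriminant is not typable yet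
(`Motives.weilDiscriminant` is abstract), so this decl is the formally stronger all-`δ` version. -/
def WeilTwelvefoldsSqrtMinus11Hyp : Prop :=
  ∀ (A : Motives.AbelianVariety ℂ) (φ : A ⟶ A), A.dim = 12 →
    φ ≫ φ = -((11 : ℤ) • 𝟙 A) →
    ∀ c : complexBetti A.X 12, IsRationalClass c → IsOfHodgeType 12 A.X 12 6 6 c →
      c ∈ Module.End.eigenspace (complexBetti.map (𝟙 A + φ).hom.hom.hom 12).hom
            ((1 + Complex.I * (Real.sqrt (11 : ℝ) : ℂ)) ^ 12) ⊔
          Module.End.eigenspace (complexBetti.map (𝟙 A + φ).hom.hom.hom 12).hom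
            ((1 - Complex.I * (Real.sqrt (11 : ℝ) : ℂ)) ^ 12) →
      c ∈ algebraicClasses A.X 6

/-- **C⁺ (all-δ shadow) + the route's `WeilDescending` ⇒ the crux**: one descending step
`(p, n) = (11, 5)` (product with a `ℚ(√-11)`-Weil surface of complementary discriminant).
Kernel-checked glue; the arithmetic `2 * (5 + 1) = 12`, `2 * 5 = 10` is definitional. -/
theorem crux_of_twelvefolds (h12 : WeilTwelvefoldsSqrtMinus11Hyp) (hD : WeilDescending) : Crux := by
  intro A φ hdim hφ c hrat hhodge hweil
  have hstep : ∀ m : ℕ, m = 5 + 1 → ∀ (B : Motives.AbelianVariety ℂ) (ψ : B ⟶ B),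
      B.dim = 2 * m → ψ ≫ ψ = -(((11 : ℕ) : ℤ) • 𝟙 B) →
      ∀ c : complexBetti B.X (2 * m), IsRationalClass c → IsOfHodgeType (2 * m) B.X (2 * m) m m c →
        c ∈ Module.End.eigenspace (complexBetti.map (𝟙 B + ψ).hom.hom.hom (2 * m)).hom
              ((1 + Complex.I * (Real.sqrt ((11 : ℕ) : ℝ) : ℂ)) ^ (2 * m)) ⊔
            Module.End.eigenspace (complexBetti.map (𝟙 B + ψ).hom.hom.hom (2 * m)).hom
              ((1 - Complex.I * (Real.sqrt ((11 : ℕ) : ℝ) : ℂ)) ^ (2 * m)) →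
        c ∈ algebraicClasses B.X m := by
    intro m hm B ψ hBdim hψ c' hc' hh' hw'
    subst hm
    have h' := h12 B ψ (by simpa using hBdim) (by simpa using hψ) c' hc' hh'
    exact h' (by simpa using hw')
  have h' := hD 11 (by norm_num) (by norm_num) (by norm_num) 5 (by norm_num) hstep A φ hdim
    (by simpa using hφ) c hrat hhodge
  exact h' (by simpa using hweil)

/-! ## (2) The seed: the Weil projector is a polynomial in `(𝟙 + φ)^*` -/

/-- The eigenvalue of `(𝟙 + φ)^*` (`φ ≫ φ = -11`) on the summand `∧ᵃV_σ ⊗ ∧ᵇV_σ̄` of `H^{a+b}(A)`: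
`λ_{a,b} = (1 + i√11)ᵃ (1 - i√11)ᵇ`. -/
def weilNode (a b : ℕ) : ℂ :=
  (1 + Complex.I * (Real.sqrt (11 : ℝ) : ℂ)) ^ a * (1 - Complex.I * (Real.sqrt (11 : ℝ) : ℂ)) ^ b

/-- **Seed arithmetic.**  For a `ℚ(√-11)`-Weil `2n`-fold `(A, φ)`: there is `p ∈ ℂ[X]` with
`p(λ_{2n,0}) = p(λ_{0,2n}) = 1` and `p(λ_{a,b}) = 0` for every other `(a, b) ∈ [0, 2n]²`.  Consequently
the algebraic cycle `p(Γ_{𝟙+φ}) = Σ_j c_j Γ_{(𝟙+φ)^j} ∈ CH^{2n}(A × A)_ℂ` (graphs of endomorphisms,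
polynomial taken for composition of correspondences) acts on `H^*(A)` as the projector onto the Weil
plane `∧²ⁿV_σ ⊕ ∧²ⁿV_σ̄` and as `0` on everything else: its cohomology class IS the Hodge–Weil class
`id_W ∈ W(A)^∨ ⊗ W(A) = W_K(A × A^c)` of the `4n`-fold `A × A^c` — an algebraic representative at EVERY
point of the diagonal `{A × A^c}` of the hyperbolic `4n`-fold component. -/
def WeilProjectorPolynomial (n : ℕ) : Prop :=
  ∃ p : Polynomial ℂ, p.eval (weilNode (2 * n) 0) = 1 ∧ p.eval (weilNode 0 (2 * n)) = 1 ∧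
    ∀ a b : ℕ, a ≤ 2 * n → b ≤ 2 * n → (a, b) ≠ (2 * n, 0) → (a, b) ≠ (0, 2 * n) →
      p.eval (weilNode a b) = 0

/-- `‖1 + i√11‖² = 12`. -/
theorem normSq_one_add : Complex.normSq (1 + Complex.I * (Real.sqrt (11 : ℝ) : ℂ)) = 12 := by
  rw [Complex.normSq_apply]
  have h : Real.sqrt (11 : ℝ) * Real.sqrt 11 = 11 := Real.mul_self_sqrt (by norm_num)
  simp
  nlinarith [h]

/-- `‖1 - i√11‖² = 12`. -/
theorem normSq_one_sub : Complex.normSq (1 - Complex.I * (Real.sqrt (11 : ℝ) : ℂ)) = 12 := by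
  rw [Complex.normSq_apply]
  have h : Real.sqrt (11 : ℝ) * Real.sqrt 11 = 11 := Real.mul_self_sqrt (by norm_num)
  simp
  nlinarith [h]

/-- `‖λ_{a,b}‖² = 12^{a+b}`. -/
theorem normSq_weilNode (a b : ℕ) : Complex.normSq (weilNode a b) = 12 ^ (a + b) := by
  rw [weilNode, map_mul, map_pow, map_pow, normSq_one_add, normSq_one_sub, pow_add]

/-- Equal nodes have equal total degree. -/
theorem add_eq_of_weilNode_eq {a b a' b' : ℕ} (h : weilNode a b = weilNode a' b') :
    a + b = a' + b' := by
  have h1 := congrArg Complex.normSq h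
  rw [normSq_weilNode, normSq_weilNode] at h1
  exact pow_right_injective₀ (by norm_num : (0 : ℝ) < 12) (by norm_num : (12 : ℝ) ≠ 1) h1

/-- A non-corner node never equals the `+` corner. -/
theorem weilNode_ne_plus {n a b : ℕ} (hab : (a, b) ≠ (2 * n, 0)) :
    weilNode a b ≠ weilNode (2 * n) 0 := by
  intro h
  have hsum : a + b = 2 * n := by simpa using add_eq_of_weilNode_eq h
  -- with `a + b = 2n` the equality reads `(1+i√11)^a (1-i√11)^b = (1+i√11)^{a+b}`
  have e : ((11 : ℕ) : ℝ) = (11 : ℝ) := by norm_num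
  have key := mixed_eq_plus_iff_of_four_le 11 (by norm_num) a b
  rw [e] at key
  have h' : (1 + Complex.I * (Real.sqrt (11 : ℝ) : ℂ)) ^ a * (1 - Complex.I * (Real.sqrt (11 : ℝ) : ℂ)) ^ b
      = (1 + Complex.I * (Real.sqrt (11 : ℝ) : ℂ)) ^ (a + b) := by
    have := h
    simp only [weilNode, pow_zero, mul_one] at this
    rw [hsum]; exact this
  have hb : b = 0 := key.1 h'
  apply hab
  subst hb
  simp at hsum
  simp [hsum]

/-- A non-corner node never equals the `-` corner. -/
theorem weilNode_ne_minus {n a b : ℕ} (hab : (a, b) ≠ (0, 2 * n)) :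
    weilNode a b ≠ weilNode 0 (2 * n) := by
  intro h
  have hsum : a + b = 2 * n := by simpa using add_eq_of_weilNode_eq h
  have e : ((11 : ℕ) : ℝ) = (11 : ℝ) := by norm_num
  have key := mixed_eq_minus_iff_of_four_le 11 (by norm_num) a b
  rw [e] at key
  have h' : (1 + Complex.I * (Real.sqrt (11 : ℝ) : ℂ)) ^ a * (1 - Complex.I * (Real.sqrt (11 : ℝ) : ℂ)) ^ b
      = (1 - Complex.I * (Real.sqrt (11 : ℝ) : ℂ)) ^ (a + b) := by
    have := h
    simp only [weilNode, pow_zero, one_mul] at this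
    rw [hsum]; exact this
  have ha : a = 0 := key.1 h'
  apply hab
  subst ha
  simp at hsum
  simp [hsum]

/-- **The seed exists for every `n ≥ 1`** (Lagrange interpolation on the finite node set). -/
theorem weilProjectorPolynomial_holds (n : ℕ) (_hn : 1 ≤ n) : WeilProjectorPolynomial n := by
  classical
  -- the finite set of all nodes in the box, as a set of complex numbers
  let box : Finset (ℕ × ℕ) := Finset.range (2 * n + 1) ×ˢ Finset.range (2 * n + 1)
  let S : Finset ℂ := box.image fun ab => weilNode ab.1 ab.2
  let r : ℂ → ℂ := fun v => if v = weilNode (2 * n) 0 ∨ v = weilNode 0 (2 * n) then 1 else 0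
  refine ⟨Lagrange.interpolate S id r, ?_, ?_, ?_⟩
  · have hmem : weilNode (2 * n) 0 ∈ S :=
      Finset.mem_image.2 ⟨(2 * n, 0), by simp [box], rfl⟩
    have := Lagrange.eval_interpolate_at_node r (Set.injOn_id _) hmem
    simpa [r] using this
  · have hmem : weilNode 0 (2 * n) ∈ S :=
      Finset.mem_image.2 ⟨(0, 2 * n), by simp [box], rfl⟩
    have := Lagrange.eval_interpolate_at_node r (Set.injOn_id _) hmem
    simp only [id] at this
    rw [this]
    simp [r]
  · intro a b ha hb hp hm
    have hmem : weilNode a b ∈ S :=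
      Finset.mem_image.2 ⟨(a, b), by simp [box]; omega, rfl⟩
    have := Lagrange.eval_interpolate_at_node r (Set.injOn_id _) hmem
    simp only [id] at this
    rw [this]
    simp [r, weilNode_ne_plus hp, weilNode_ne_minus hm]

/-- The instances used by the card: `n = 3` (host `A₆ × A₆^c`, the 12-fold transfer C⁺) and
`n = 5` (host `A × A^c` for the crux's tenfold itself, the frozen-factor slice). -/
theorem weilProjectorPolynomial_three : WeilProjectorPolynomial 3 :=
  weilProjectorPolynomial_holds 3 (by norm_num)

theorem weilProjectorPolynomial_five : WeilProjectorPolynomial 5 :=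
  weilProjectorPolynomial_holds 5 (by norm_num)

end Summit.HodgeConjecture.HodgeConjecture.Cruxes.WeilTenfoldsSqrtMinus11.IdeatorTwoG2

end
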